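import Summits.Ventures.PercRepro.RankLevelSetExplicitLin2Key
import Summits.Ventures.PercRepro.RankLevelSetExplicitLin2RowEleven

/-!
# PercRepro — THE LEVEL-12 ROW OF C-025 FROM THE CHAIN'S OWN FLOOR `p ≥ 40 204` (p9, S4)

`proofs/SUBCLAIM-S4-p9.md` §S4.3⁗. THEOREM U states level `12` from `p ≥ 98 305` (`q·2^{q+1} + 1`). The assembled
inequality `(P_d)` of its chain holds, exactly evaluated, at EVERY core corank `13 ≤ d ≤ 4108` from `p = 40 204` — and fails at
`p = 40 203` (corank `2 547`): the integer key `KeyP 12 40204 d` (RankLevelSetExplicitLin2Key) is checked by the kernel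
at the 4 096 coranks (`decide`, 1 chunk of 4 096), the key is monotone in the rank (`keyP_mono`), and the wrapper
`c025_level_succ_of_keyP_row` assembles the level from the level-11 row `c025_eleven_from_18780` (RankLevelSetExplicitLin2RowEleven):
**`c025_twelve_from_40204 (M) (p) (hp : 40204 ≤ p) : RLS M p 12`** — the level-12 threshold `98 305` of THEOREM U
becomes `40 204` (`0.409·q·2^{q+1}`), the floor of the counting method itself. Axioms: standard.
-/

open scoped Matroid

namespace PercRepro

namespace ThmN

namespace Explicit

/-- **THE KEY ROW AT `(q, p) = (12, 40 204)`**: `KeyP 12 40204 d` at every corank `13 ≤ d ≤ 4108`, by the kernel. -/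
theorem key_twelve_row : ∀ t < 4096, KeyP 12 40204 (13 + t) := by decide +kernel

/-- **THE FLOOR IS EXACT**: the key FAILS at `p = 40 203`, corank `2 547` (the big class's saturation corank), by the kernel. -/
theorem key_twelve_sharp : ¬ KeyP 12 40203 2547 := by decide +kernel

end Explicit

variable {α : Type}

/-- **THE LEVEL-12 ROW FROM `40 204`**: C-025 at level `12` for every finite matroid and every `p ≥ 40 204` — the key row
at `40 204`, its monotonicity in `p`, the wrapper `c025_level_succ_of_keyP_row` (`N₁(12) = 8 532`, tail `12 365`) and
the level-11 row `c025_eleven_from_18780` (RankLevelSetExplicitLin2RowEleven) at `p − 1`. -/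
theorem c025_twelve_from_40204 (M : Matroid α) [M.Finite] (p : ℕ) (hp : 40204 ≤ p) : RLS M p 12 :=
  c025_level_succ_of_keyP_row 11 (by norm_num) 40204 (by norm_num) (by norm_num) Explicit.key_twelve_row
    (fun M' _ p' hp' => c025_eleven_from_18780 M' p' (by omega)) M p hp

/-- The same in the literal `C025` body: `phiK p 12 · #U(p, 12) ≤ #Y(p, 12)` for every finite matroid and every `p ≥ 40 204`. -/
theorem c025_twelve_from_40204' (M : Matroid α) [M.Finite] (p : ℕ) (hp : 40204 ≤ p) :
    phiK p 12 * ({A : Set α | A ⊆ M.E ∧ M.eRk A = (p : ℕ∞) ∧ M.eRk (M.E \ A) = (12 : ℕ∞)}.ncard : ℚ) ≤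
      ({A : Set α | A ⊆ M.E ∧ (12 : ℕ∞) < M.eRk A ∧ M.eRk A < (p : ℕ∞)}.ncard : ℚ) :=
  c025_twelve_from_40204 M p hp

end ThmN

end PercRepro
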